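import Literature.AlgebraicGeometry.Motives.HodgeLieRankLowerBound
import Literature.AlgebraicGeometry.Motives.HodgeThetaSubalgebraRealPlacesSl2
import Mathlib.Algebra.Lie.Killing
import Mathlib.LinearAlgebra.Matrix.ToLin
import HarnessLib

/-!
# Rational structures on operator Lie algebras: bases, bilinear forms and the Killing form under `𝔤 ↦ 𝔤_ℂ = spanC 𝔤`

Family `hodge`, layer `Literature/AlgebraicGeometry/Motives` (namespace `HodgeStructure`, continuing the `spanC` section of
`HodgeThetaSubalgebraRealPlacesSl2` and `finrank_span_baseChange_image` of `HodgeLieRankLowerBound`). THEOREMS ONLY (no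
definition, no named fact; D-0026). Written for the cell `pub-hodgecm2` (COR-CM) lane MT-RANK-SEVEN-TYPEIII, seat `b27`:
the «Galois swap» of the two complex factors of a `ℚ`-simple Hodge Lie algebra is performed through RATIONAL invariant
bilinear forms, and this file supplies the passage between a rational subspace `𝔤 ⊆ End_ℚ V` and its complex span
`𝔤_ℂ = spanC 𝔤 ⊆ End_ℂ V_ℂ` for such forms (Deligne, LNM 900 I §3, proof of 3.4: «rational structures»).

* `exists_basis_spanC` — a `ℚ`-basis `b` of `𝔤` gives the `ℂ`-basis `i ↦ (b i)_ℂ` of every `ℂ`-subspace `𝔤'` with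
  `𝔤' = spanC 𝔤`, with coordinates of `X_ℂ` (`X ∈ 𝔤`) equal to those of `X`.
* **`exists_ne_zero_orthogonal_of_spanC`** (DESCENT OF DEGENERACY) — if `β : 𝔤 × 𝔤 → ℚ` is bilinear and `β'` on `𝔤'`
  is linear in its second argument with `β'(X_ℂ, Y_ℂ) = β(X, Y)`, and some `x' ≠ 0` in `𝔤'` has `β'(y', x') = 0` for all
  `y'`, then some `x ≠ 0` in `𝔤` has `β(y, x) = 0` for all `y` (the Gram determinant of `β` vanishes in `ℂ`, hence in `ℚ`).
* `forall_eq_zero_of_spanC` (ASCENT) — if `β = 0` and `β'` is bilinear with `β'(X_ℂ, Y_ℂ) = β(X, Y)` then `β' = 0`.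
* **`killingForm_spanC`** — for Lie subalgebras `𝔏 ≤ 𝔤𝔩_ℚ(V)`, `𝔏' ≤ 𝔤𝔩_ℂ(V_ℂ)` (commutator brackets) with
  `𝔏' = spanC 𝔏`: `κ_{𝔏'}(X_ℂ, Y_ℂ) = κ_𝔏(X, Y)` (the Killing form commutes with extension of scalars; cf. Mathlib
  `LieModule.traceForm_baseChange` for the abstract tensor product); `trace_baseChange_mul_mul` — `tr(z_ℂ X_ℂ Y_ℂ) = tr(z X Y)`.

## References

* [Deligne1982HodgeCycles] P. Deligne, *Hodge cycles on abelian varieties*, LNM 900 (1982), I §3 (proof of Prop. 3.4).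
* [Humphreys1972] J. E. Humphreys, *Introduction to Lie Algebras and Representation Theory*, GTM 9 (1972), §5.1 (Killing
  form), §8.1.
-/

noncomputable section

open scoped TensorProduct

namespace Literature.AlgebraicGeometry.Motives

universe u

namespace HodgeStructure

variable {V : Type u} [AddCommGroup V] [Module ℚ V] [Module.Finite ℚ V]

/-! ## §1 The basis `(b i)_ℂ` of `𝔤_ℂ` -/

/-- **A `ℚ`-basis of `𝔤` base-changes to a `ℂ`-basis of `𝔤_ℂ = spanC 𝔤`**, with the same coordinates on rational
elements: `(X_ℂ)`'s `i`-th coordinate is `X`'s. [cite: Deligne1982HodgeCycles, I §3 (proof of Prop. 3.4)] -/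
theorem exists_basis_spanC (𝔤 : Submodule ℚ (Module.End ℚ V)) {ι : Type*} [Fintype ι] (b : Module.Basis ι ℚ 𝔤)
    (𝔤' : Submodule ℂ (Module.End ℂ (ℂ ⊗[ℚ] V))) (h𝔤' : 𝔤' = spanC 𝔤) :
    ∃ b' : Module.Basis ι ℂ 𝔤', (∀ i, (b' i : Module.End ℂ (ℂ ⊗[ℚ] V)) = ((b i : 𝔤) : Module.End ℚ V).baseChange ℂ) ∧
      ∀ (X : 𝔤) (hX : (X : Module.End ℚ V).baseChange ℂ ∈ 𝔤') (i : ι),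
        b'.repr ⟨(X : Module.End ℚ V).baseChange ℂ, hX⟩ i = algebraMap ℚ ℂ (b.repr X i) := by
  classical
  subst h𝔤'
  -- the family
  let f : ι → spanC 𝔤 := fun i => ⟨((b i : 𝔤) : Module.End ℚ V).baseChange ℂ, baseChange_mem_spanC (b i).2⟩
  -- rational elements are combinations of the family with rational coefficients
  have hsum : ∀ X : 𝔤, (⟨(X : Module.End ℚ V).baseChange ℂ, baseChange_mem_spanC X.2⟩ : spanC 𝔤) =
      ∑ i, (algebraMap ℚ ℂ (b.repr X i)) • f i := by
    intro X
    apply Subtype.ext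
    rw [Submodule.coe_sum]
    have hX : (X : Module.End ℚ V) = ∑ i, b.repr X i • ((b i : 𝔤) : Module.End ℚ V) := by
      conv_lhs => rw [← b.sum_repr X]
      rw [Submodule.coe_sum]
      rfl
    change LinearMap.baseChangeHom ℚ ℂ V V (X : Module.End ℚ V) = _
    rw [hX, map_sum]
    refine Finset.sum_congr rfl fun i _ => ?_
    rw [map_smul, Submodule.coe_smul, algebraMap_smul]
    rfl
  -- it spans
  have hspan : ⊤ ≤ Submodule.span ℂ (Set.range f) := by
    rintro ⟨Y, hY⟩ -
    have hY' := hY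
    unfold spanC at hY'
    refine Submodule.span_induction (p := fun Z hZ => (⟨Z, hZ⟩ : spanC 𝔤) ∈ Submodule.span ℂ (Set.range f)) ?_ ?_ ?_ ?_ hY
    · rintro _ ⟨X, hX, rfl⟩
      have h := hsum ⟨X, hX⟩
      change (⟨X.baseChange ℂ, _⟩ : spanC 𝔤) ∈ _
      rw [show (⟨X.baseChange ℂ, baseChange_mem_spanC hX⟩ : spanC 𝔤) = ∑ i, (algebraMap ℚ ℂ (b.repr ⟨X, hX⟩ i)) • f i
        from h]
      exact Submodule.sum_mem _ fun i _ => Submodule.smul_mem _ _ (Submodule.subset_span ⟨i, rfl⟩)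
    · exact Submodule.zero_mem _
    · intro x y _ _ hx hy
      exact Submodule.add_mem _ hx hy
    · intro c x _ hx
      exact Submodule.smul_mem _ c hx
  -- cardinality, hence a basis
  have hcard : Fintype.card ι = Module.finrank ℂ (spanC 𝔤) := by
    rw [← Module.finrank_eq_card_basis b]
    exact (finrank_span_baseChange_image 𝔤).symm
  have hli : LinearIndependent ℂ f := linearIndependent_of_top_le_span_of_card_eq_finrank hspan hcard
  let b' : Module.Basis ι ℂ (spanC 𝔤) := Module.Basis.mk hli hspan
  have hb' : ∀ i, b' i = f i := fun i => Module.Basis.mk_apply hli hspan i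
  refine ⟨b', fun i => by rw [hb'], fun X hX i => ?_⟩
  have h := hsum X
  have hrepr : b'.repr (∑ i, (algebraMap ℚ ℂ (b.repr X i)) • f i) = fun j => algebraMap ℚ ℂ (b.repr X j) := by
    simp only [map_sum, map_smul, ← hb', b'.repr_self]
    ext j
    simp [Finsupp.single_apply]
  have hmem : (⟨(X : Module.End ℚ V).baseChange ℂ, hX⟩ : spanC 𝔤) = ∑ i, (algebraMap ℚ ℂ (b.repr X i)) • f i := h
  rw [hmem, hrepr]

/-! ## §2 Descent and ascent of degeneracy -/

/-- **DESCENT OF DEGENERACY.**  `β` a `ℚ`-bilinear form on `𝔤`, `β'` on `𝔤' = spanC 𝔤` additive and `ℂ`-homogeneous in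
its second argument with `β'(X_ℂ, Y_ℂ) = β(X, Y)`; if some `x' ≠ 0` in `𝔤'` is right-orthogonal to `𝔤'`, then some
`x ≠ 0` in `𝔤` is right-orthogonal to `𝔤` (the Gram determinant of `β` in a rational basis is a rational number that
vanishes in `ℂ`). [cite: Deligne1982HodgeCycles, I §3 (proof of Prop. 3.4)] -/
theorem exists_ne_zero_orthogonal_of_spanC (𝔤 : Submodule ℚ (Module.End ℚ V))
    (𝔤' : Submodule ℂ (Module.End ℂ (ℂ ⊗[ℚ] V))) (h𝔤' : 𝔤' = spanC 𝔤) (β : LinearMap.BilinForm ℚ 𝔤)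
    (β' : 𝔤' → 𝔤' → ℂ) (hadd : ∀ y x x' : 𝔤', β' y (x + x') = β' y x + β' y x')
    (hsmul : ∀ (c : ℂ) (y x : 𝔤'), β' y (c • x) = c * β' y x)
    (hcompat : ∀ (X Y : 𝔤) (hX : (X : Module.End ℚ V).baseChange ℂ ∈ 𝔤') (hY : (Y : Module.End ℚ V).baseChange ℂ ∈ 𝔤'),
      β' ⟨_, hX⟩ ⟨_, hY⟩ = algebraMap ℚ ℂ (β X Y))
    {x' : 𝔤'} (hx' : x' ≠ 0) (hrad : ∀ y' : 𝔤', β' y' x' = 0) :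
    ∃ x : 𝔤, x ≠ 0 ∧ ∀ y : 𝔤, β y x = 0 := by
  classical
  obtain ⟨b⟩ : Nonempty (Module.Basis (Fin (Module.finrank ℚ 𝔤)) ℚ 𝔤) := ⟨Module.finBasis ℚ 𝔤⟩
  obtain ⟨b', hb', hrepr⟩ := exists_basis_spanC 𝔤 b 𝔤' h𝔤'
  have hmemb : ∀ i, (((b i : 𝔤) : Module.End ℚ V).baseChange ℂ) ∈ 𝔤' := fun i => by rw [← hb' i]; exact (b' i).2
  have hb'eq : ∀ i, b' i = ⟨((b i : 𝔤) : Module.End ℚ V).baseChange ℂ, hmemb i⟩ := fun i => Subtype.ext (hb' i)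
  -- the rational Gram matrix and its complex image
  set G : Matrix (Fin (Module.finrank ℚ 𝔤)) (Fin (Module.finrank ℚ 𝔤)) ℚ := fun i j => β (b i) (b j) with hG
  have hG' : ∀ i j, β' (b' i) (b' j) = algebraMap ℚ ℂ (G i j) := by
    intro i j
    rw [hb'eq i, hb'eq j, hcompat]
  -- the coordinates of `x'` are a non-zero complex kernel vector of `Gᵀ ↦ G` (right radical ↔ `G *ᵥ c = 0`)
  set c : Fin (Module.finrank ℚ 𝔤) → ℂ := fun i => b'.repr x' i with hc
  have hx'sum : x' = ∑ i, c i • b' i := by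
    conv_lhs => rw [← b'.sum_repr x']
  have hc0 : c ≠ 0 := by
    intro h0
    apply hx'
    rw [hx'sum]
    simp [h0]
  have hker : (G.map (algebraMap ℚ ℂ)).mulVec c = 0 := by
    funext i
    have h := hrad (b' i)
    rw [hx'sum] at h
    have hexp : β' (b' i) (∑ j, c j • b' j) = ∑ j, c j * β' (b' i) (b' j) := by
      induction (Finset.univ : Finset (Fin (Module.finrank ℚ 𝔤))) using Finset.induction_on with
      | empty =>
        rw [Finset.sum_empty, Finset.sum_empty]
        have h0 := hsmul 0 (b' i) (b' i)
        rw [zero_smul, zero_mul] at h0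
        exact h0
      | insert j s hj ih => rw [Finset.sum_insert hj, Finset.sum_insert hj, hadd, hsmul, ih]
    rw [hexp] at h
    rw [Matrix.mulVec, Pi.zero_apply]
    change ∑ j, (G.map (algebraMap ℚ ℂ)) i j * c j = 0
    rw [← h]
    refine Finset.sum_congr rfl fun j _ => ?_
    rw [Matrix.map_apply, ← hG' i j, mul_comm]
  have hdetC : (G.map (algebraMap ℚ ℂ)).det = 0 :=
    (Matrix.exists_mulVec_eq_zero_iff).1 ⟨c, hc0, hker⟩
  have hdet : G.det = 0 := by
    have h : algebraMap ℚ ℂ G.det = 0 := by rw [RingHom.map_det]; exact hdetC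
    exact (algebraMap ℚ ℂ).injective (by rw [h, map_zero])
  obtain ⟨v, hv0, hv⟩ := (Matrix.exists_mulVec_eq_zero_iff).2 hdet
  refine ⟨∑ j, v j • b j, ?_, fun y => ?_⟩
  · intro h0
    apply hv0
    have hli := b.linearIndependent
    rw [Fintype.linearIndependent_iff] at hli
    funext j
    exact hli v h0 j
  · -- `β y x = Σ_i y_i Σ_j G i j v j = 0`
    have hrow : ∀ i, β (b i) (∑ j, v j • b j) = 0 := by
      intro i
      have h := congr_fun hv i
      rw [Matrix.mulVec, Pi.zero_apply] at h
      change ∑ j, G i j * v j = 0 at h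
      rw [map_sum]
      simp only [map_smul, smul_eq_mul]
      rw [← h]
      exact Finset.sum_congr rfl fun j _ => mul_comm _ _
    have hy : y = ∑ i, b.repr y i • b i := (b.sum_repr y).symm
    rw [hy, LinearMap.map_sum₂]
    simp only [LinearMap.map_smul₂, hrow, smul_zero, Finset.sum_const_zero]

/-- **ASCENT.**  If `β = 0` on `𝔤` and `β'` on `𝔤' = spanC 𝔤` is bilinear with `β'(X_ℂ, Y_ℂ) = β(X, Y)`, then `β' = 0`.
[cite: Deligne1982HodgeCycles, I §3 (proof of Prop. 3.4)] -/
theorem forall_eq_zero_of_spanC (𝔤 : Submodule ℚ (Module.End ℚ V))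
    (𝔤' : Submodule ℂ (Module.End ℂ (ℂ ⊗[ℚ] V))) (h𝔤' : 𝔤' = spanC 𝔤) (β : LinearMap.BilinForm ℚ 𝔤)
    (β' : 𝔤' → 𝔤' → ℂ) (hadd : ∀ y x x' : 𝔤', β' y (x + x') = β' y x + β' y x')
    (hsmul : ∀ (c : ℂ) (y x : 𝔤'), β' y (c • x) = c * β' y x)
    (hadd' : ∀ x x' y : 𝔤', β' (x + x') y = β' x y + β' x' y)
    (hsmul' : ∀ (c : ℂ) (x y : 𝔤'), β' (c • x) y = c * β' x y)
    (hcompat : ∀ (X Y : 𝔤) (hX : (X : Module.End ℚ V).baseChange ℂ ∈ 𝔤') (hY : (Y : Module.End ℚ V).baseChange ℂ ∈ 𝔤'),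
      β' ⟨_, hX⟩ ⟨_, hY⟩ = algebraMap ℚ ℂ (β X Y))
    (hβ : ∀ x y : 𝔤, β x y = 0) (x' y' : 𝔤') : β' x' y' = 0 := by
  classical
  obtain ⟨b⟩ : Nonempty (Module.Basis (Fin (Module.finrank ℚ 𝔤)) ℚ 𝔤) := ⟨Module.finBasis ℚ 𝔤⟩
  obtain ⟨b', hb', -⟩ := exists_basis_spanC 𝔤 b 𝔤' h𝔤'
  have hmemb : ∀ i, (((b i : 𝔤) : Module.End ℚ V).baseChange ℂ) ∈ 𝔤' := fun i => by rw [← hb' i]; exact (b' i).2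
  have hb'eq : ∀ i, b' i = ⟨((b i : 𝔤) : Module.End ℚ V).baseChange ℂ, hmemb i⟩ := fun i => Subtype.ext (hb' i)
  have hgen : ∀ i j, β' (b' i) (b' j) = 0 := by
    intro i j
    rw [hb'eq i, hb'eq j, hcompat, hβ, map_zero]
  -- expand both arguments in the basis `b'`
  have hexp2 : ∀ (z : 𝔤') (c : Fin (Module.finrank ℚ 𝔤) → ℂ) (s : Finset (Fin (Module.finrank ℚ 𝔤))),
      β' z (∑ j ∈ s, c j • b' j) = ∑ j ∈ s, c j * β' z (b' j) := by
    intro z c s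
    induction s using Finset.induction_on with
    | empty =>
      rw [Finset.sum_empty, Finset.sum_empty]
      have h0 := hsmul 0 z z
      rw [zero_smul, zero_mul] at h0
      exact h0
    | insert j s hj ih => rw [Finset.sum_insert hj, Finset.sum_insert hj, hadd, hsmul, ih]
  have hexp1 : ∀ (z : 𝔤') (c : Fin (Module.finrank ℚ 𝔤) → ℂ) (s : Finset (Fin (Module.finrank ℚ 𝔤))),
      β' (∑ j ∈ s, c j • b' j) z = ∑ j ∈ s, c j * β' (b' j) z := by
    intro z c s
    induction s using Finset.induction_on with
    | empty =>
      rw [Finset.sum_empty, Finset.sum_empty]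
      have h0 := hsmul' 0 z z
      rw [zero_smul, zero_mul] at h0
      exact h0
    | insert j s hj ih => rw [Finset.sum_insert hj, Finset.sum_insert hj, hadd', hsmul', ih]
  have hx : x' = ∑ i, b'.repr x' i • b' i := by
    conv_lhs => rw [← b'.sum_repr x']
  have hy : y' = ∑ i, b'.repr y' i • b' i := by
    conv_lhs => rw [← b'.sum_repr y']
  rw [hx, hexp1, Finset.sum_eq_zero]
  intro i _
  rw [hy, hexp2, Finset.sum_eq_zero, mul_zero]
  intro j _
  rw [hgen, mul_zero]

/-! ## §3 The Killing form and twisted trace forms commute with `𝔤 ↦ 𝔤_ℂ` -/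

/-- `tr_{V_ℂ}(z_ℂ X_ℂ Y_ℂ) = tr_V(z X Y)`. [cite: Deligne1982HodgeCycles, I §3 (proof of Prop. 3.4)] -/
theorem trace_baseChange_mul_mul (z X Y : Module.End ℚ V) :
    LinearMap.trace ℂ (ℂ ⊗[ℚ] V) (z.baseChange ℂ * X.baseChange ℂ * Y.baseChange ℂ) =
      algebraMap ℚ ℂ (LinearMap.trace ℚ V (z * X * Y)) := by
  rw [← LinearMap.baseChange_mul, ← LinearMap.baseChange_mul, LinearMap.trace_baseChange]

/-- **The Killing form commutes with `𝔏 ↦ 𝔏_ℂ`**: for Lie subalgebras `𝔏 ≤ 𝔤𝔩_ℚ(V)` and `𝔏' ≤ 𝔤𝔩_ℂ(V_ℂ)` (commutator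
brackets) with `𝔏' = spanC 𝔏`, and `X, Y ∈ 𝔏`: `κ_{𝔏'}(X_ℂ, Y_ℂ) = κ_𝔏(X, Y)` — in the bases `b`, `(b i)_ℂ` the operators
`ad X ad Y` and `ad X_ℂ ad Y_ℂ` have the same (rational) matrix. [cite: Humphreys1972, §5.1]
[cite: Deligne1982HodgeCycles, I §3 (proof of Prop. 3.4)] -/
theorem killingForm_spanC :
    letI : LieRing (Module.End ℚ V) := LieRing.ofAssociativeRing
    letI : LieRing (Module.End ℂ (ℂ ⊗[ℚ] V)) := LieRing.ofAssociativeRing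
    ∀ (𝔏 : LieSubalgebra ℚ (Module.End ℚ V)) (𝔏' : LieSubalgebra ℂ (Module.End ℂ (ℂ ⊗[ℚ] V)))
      (_h𝔏' : 𝔏'.toSubmodule = spanC 𝔏.toSubmodule) (X Y : 𝔏) (X' Y' : 𝔏'),
      (X' : Module.End ℂ (ℂ ⊗[ℚ] V)) = (X : Module.End ℚ V).baseChange ℂ →
      (Y' : Module.End ℂ (ℂ ⊗[ℚ] V)) = (Y : Module.End ℚ V).baseChange ℂ →
      killingForm ℂ 𝔏' X' Y' = algebraMap ℚ ℂ (killingForm ℚ 𝔏 X Y) := by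
  letI : LieRing (Module.End ℚ V) := LieRing.ofAssociativeRing
  letI : LieRing (Module.End ℂ (ℂ ⊗[ℚ] V)) := LieRing.ofAssociativeRing
  intro 𝔏 𝔏' h𝔏' X Y X' Y' hX' hY'
  classical
  haveI : Module.Finite ℚ 𝔏 := Module.Finite.of_injective 𝔏.toSubmodule.subtype Subtype.val_injective
  obtain ⟨b⟩ : Nonempty (Module.Basis (Fin (Module.finrank ℚ 𝔏)) ℚ 𝔏) := ⟨Module.finBasis ℚ 𝔏⟩
  obtain ⟨b'₀, hb'₀, hrepr₀⟩ := exists_basis_spanC 𝔏.toSubmodule b 𝔏'.toSubmodule h𝔏'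
  let b' : Module.Basis (Fin (Module.finrank ℚ 𝔏)) ℂ 𝔏' := b'₀
  have hb' : ∀ i, ((b' i : 𝔏') : Module.End ℂ (ℂ ⊗[ℚ] V)) = ((b i : 𝔏) : Module.End ℚ V).baseChange ℂ := hb'₀
  have hrepr : ∀ (Z : 𝔏) (hZ : (Z : Module.End ℚ V).baseChange ℂ ∈ 𝔏') (i : Fin (Module.finrank ℚ 𝔏)),
      b'.repr ⟨(Z : Module.End ℚ V).baseChange ℂ, hZ⟩ i = algebraMap ℚ ℂ (b.repr Z i) := hrepr₀
  -- the bracket `⁅X, ⁅Y, b i⁆⁆` and its complexification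
  have hbr : ∀ i, ((⁅X', ⁅Y', b' i⁆⁆ : 𝔏') : Module.End ℂ (ℂ ⊗[ℚ] V)) =
      ((⁅X, ⁅Y, b i⁆⁆ : 𝔏) : Module.End ℚ V).baseChange ℂ := by
    intro i
    simp only [LieSubalgebra.coe_bracket, LieRing.of_associative_ring_bracket, hX', hY', hb',
      LinearMap.baseChange_sub, LinearMap.baseChange_mul]
  have hmem : ∀ i, ((⁅X, ⁅Y, b i⁆⁆ : 𝔏) : Module.End ℚ V).baseChange ℂ ∈ 𝔏' := fun i => by
    rw [← hbr i]; exact (⁅X', ⁅Y', b' i⁆⁆ : 𝔏').2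
  have h1 : ∀ i, (⁅X', ⁅Y', b' i⁆⁆ : 𝔏') = ⟨((⁅X, ⁅Y, b i⁆⁆ : 𝔏) : Module.End ℚ V).baseChange ℂ, hmem i⟩ := fun i =>
    Subtype.ext (hbr i)
  rw [killingForm_apply_apply, killingForm_apply_apply, LinearMap.trace_eq_matrix_trace ℚ b,
    LinearMap.trace_eq_matrix_trace ℂ b', Matrix.trace, Matrix.trace, map_sum]
  refine Finset.sum_congr rfl fun i _ => ?_
  rw [Matrix.diag_apply, Matrix.diag_apply, LinearMap.toMatrix_apply, LinearMap.toMatrix_apply, LinearMap.comp_apply,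
    LinearMap.comp_apply, LieAlgebra.ad_apply, LieAlgebra.ad_apply, LieAlgebra.ad_apply, LieAlgebra.ad_apply, h1 i,
    hrepr _ (hmem i) i]

end HodgeStructure

end Literature.AlgebraicGeometry.Motives

end
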